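import Literature.Probability.RandomPlanarGeometry.SAWCountZdSymbolSecondCancellation
import Literature.Probability.RandomPlanarGeometry.SAWCountZdStirlingThirdCoefficient
import HarnessLib

/-!
# THIRD CANCELLATION (conditional core): `[X^{2j−5}] B_j = 0` for every `j ≥ 5`, given the second- and third-layer laws of `R_i`, `3 ≤ i ≤ j`

Topic `Literature/Probability/RandomPlanarGeometry` (the «SYMBOL POLYNOMIALITY» programme for `c_n(ℤ^d)`, THIRD layer: `SAWCountZdSymbolSecondCancellation.lean`
(a-p1 g26: `SecondLayerSums`, the SECOND CANCELLATION core), `SAWCountZdStirlingThirdCoefficient.lean` (a-p1 g26: `[X^{2k−2}] E_k`),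
`SAWCountZdSymbolFirstCancellation.lean` (a-p1 g26: `symbolCorrPoly`, `coeffPoly`, `stirlingPoly`), `SAWCountZdSymbolSecondCoefficient.lean` (a-p1 g26:
`coeff_symbolPoly_two_mul_sub_four_of_sums`), `SAWCountZdSymbolLeadingCoefficient.lean` (a-p1 g25: `coeff_symbolPoly_two_mul_sub_three`)).

PRINTED CONTEXT (locators only; nothing below is in print). Madras–Slade (1993) §1.1 eq. (1.1.8) p. 5 (the `1/d` expansion of `μ`), Definition 1.2.4
(memory / finite-memory walks), §1.2 p. 10; Clisby–Liang–Slade (2007) §3.3 eqs. (29)/(31) (the `1/d` coefficients of `c_n`). Stanley EC1 §1.3 Prop. 1.3.7 eq. (1.28)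
(Stirling numbers of the first kind; the `E_k`).

THE THEOREM. `[X^{n−j}] P_n = 2^n S_j(n)`, `S_j = A_j − B_j`, `B_j = Σ_{i=2}^{j} R_i(X)·E_{j−i}(X−i)`, `deg R_i = 2i−3`, `deg E_k = 2k`. FIRST CANCELLATION (#1427):
`[X^{2j−3}]B_j = 0`; SECOND (`SAWCountZdSymbolSecondCancellation`): `[X^{2j−4}]B_j = 0` (`j ≥ 4`) given `SecondLayerSums i`. HERE: ★ `ThirdLayerCoeff i` — the
THIRD-LAYER LAW **`[X^{2i−5}] R_i = (8i⁴ − 13i³ − 8i² + 28i − 48)/(9·2^i·(i−2)!)`** as a hypothesis on `3 ≤ i ≤ j` (FINDING-ZD-SYMBOL-POLYNOMIALITY §16 (ii): it is the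
six-corner formula with the three third-layer censuses `T_i = M_i(2i,2i−5)`, `X_i = M_i(2i−1,2i−5)`, `W_i = M_i(2i−2,2i−5)` in closed form; it reproduces the tree's
`R₃ … R₆`: `29/8, 4, 121/64, 77/144`); ★★★ `coeff_symbolCorrPoly_two_mul_sub_five_eq_zero` — for every `j ≥ 5`, IF `SecondLayerSums i` and `ThirdLayerCoeff i` hold
for `3 ≤ i ≤ j` THEN **`[X^{2j−5}] B_j = 0`**; ★★★ `natDegree_symbolCorrPoly_le_sub_six` — hence `deg B_j ≤ 2j − 6`; ★★ `natDegree_coeffPoly_le_of_thirdLayer` —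
`deg S_j ≤ max(j, 2j−6)`. MECHANISM (★ `thirdTermVal`, `coeff_third_term_self/lt/two`, ★ `sum_thirdTermVal_eq_zero`): with `m = i − 2`, `k = j − i` the `X^{2j−5}`
coefficient of the `i`-th summand is `(−1)^k·P(i;j)/(18·2^j·m!·k!)` with
`P(i;j) = 4j⁴ − 13j² − 9j − 96 + i(8j³ − 8j² − 20j + 65) + i²(4j² − 18j + 17)` — of degree only TWO in `i` although it is assembled from the quartic third Stirling
coefficient and cubic cross terms (the «DEGREE COLLAPSE» of §16 (iv)) — so `Σ_m (−1)^m C(N,m)·(A + Bm + Cm²) = 0` (`N = j − 2 ≥ 3`; three alternating binomial sums)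
kills it. For `j ≤ 4` nothing cancels (`[X³]B_4 = 1/32`), as it must.

THIS FILE (lane «pcv-sawmu», a-p1 g26; all PROVED, standard axioms): plumbing `coeff_mul_three_of_natDegree_le`, `coeff_mul_three_of_natDegree_le_two`,
`coeff_comp_X_add_C_of_natDegree_le_succ`, `coeff_comp_X_add_C_of_natDegree_le_succ_succ`, `altBinom_shift`, `altBinom_sums`,
`stirling_shift_coeffs` (private); `thirdTermVal`, `ThirdLayerCoeff`, `coeff_third_term_self`, `coeff_third_term_lt`, `coeff_third_term_two`, ★ `sum_thirdTermVal_eq_zero`,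
★★★ `coeff_symbolCorrPoly_two_mul_sub_five_eq_zero`, ★★★ `natDegree_symbolCorrPoly_le_sub_six`, ★★ `natDegree_coeffPoly_le_of_thirdLayer`.
[cite: MadrasSlade1993, §1.1 eq. (1.1.8) p. 5; Definition 1.2.4; §1.2 (p. 10)] [cite: ClisbyLiangSlade2007, §3.3 eqs. (29)/(31)] [cite: Stanley2012EC1, §1.3 Prop. 1.3.7 eq. (1.28)]

Provenance: lane «pcv-sawmu», a-p1 g26 (2026-08-28).
-/

noncomputable section

open Finset
open scoped BigOperators
open Literature.Probability.LatticeModels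
open Literature.Probability.RandomPlanarGeometry.SAW
open Literature.Probability.Percolation

namespace Literature.Probability.RandomPlanarGeometry.SAW.Zd

namespace WordTypes

/-! ### Polynomial plumbing: three coefficients of a product and of a shift -/

/-- `[X^{dp+dq+2}](p·q) = p_{dp} q_{dq+2} + p_{dp+1} q_{dq+1} + p_{dp+2} q_{dq}` when `deg p ≤ dp + 2`, `deg q ≤ dq + 2`.
[cite: Stanley2012EC1, §1.3 Prop. 1.3.7 eq. (1.28); lane plumbing] -/
private theorem coeff_mul_three_of_natDegree_le (p q : Polynomial ℚ) (dp dq : ℕ) (hp : p.natDegree ≤ dp + 2) (hq : q.natDegree ≤ dq + 2) :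
    (p * q).coeff (dp + dq + 2) = p.coeff dp * q.coeff (dq + 2) + p.coeff (dp + 1) * q.coeff (dq + 1) + p.coeff (dp + 2) * q.coeff dq := by
  rw [Polynomial.coeff_mul]
  have hT : ({(dp, dq + 2), (dp + 1, dq + 1), (dp + 2, dq)} : Finset (ℕ × ℕ)) ⊆ Finset.HasAntidiagonal.antidiagonal (dp + dq + 2) := by
    intro x hx
    simp only [Finset.mem_insert, Finset.mem_singleton] at hx
    rw [Finset.HasAntidiagonal.mem_antidiagonal]
    rcases hx with rfl | rfl | rfl <;> dsimp only <;> omega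
  rw [← Finset.sum_subset hT]
  · rw [Finset.sum_insert (by simp), Finset.sum_insert (by simp), Finset.sum_singleton]
    ring
  · intro x hx hxT
    rw [Finset.HasAntidiagonal.mem_antidiagonal] at hx
    simp only [Finset.mem_insert, Finset.mem_singleton, not_or] at hxT
    by_cases h1 : dp + 2 < x.1
    · rw [Polynomial.coeff_eq_zero_of_natDegree_lt (lt_of_le_of_lt hp h1), zero_mul]
    · by_cases h2 : dq + 2 < x.2
      · rw [Polynomial.coeff_eq_zero_of_natDegree_lt (lt_of_le_of_lt hq h2), mul_zero]
      · exfalso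
        obtain ⟨a, b⟩ := x
        dsimp only at hx h1 h2 hxT
        rcases hxT with ⟨hA, hB, hC⟩
        have : a = dp ∨ a = dp + 1 ∨ a = dp + 2 := by omega
        rcases this with rfl | rfl | rfl
        · exact hA (Prod.ext rfl (by dsimp only; omega))
        · exact hB (Prod.ext rfl (by dsimp only; omega))
        · exact hC (Prod.ext rfl (by dsimp only; omega))

/-- `[X^n](p·q) = p₀ q_n + p₁ q_{n−1} + p₂ q_{n−2}` when `deg p ≤ 2` and `n ≥ 2`. [cite: Stanley2012EC1, §1.3 Prop. 1.3.7 eq. (1.28); lane plumbing] -/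
private theorem coeff_mul_three_of_natDegree_le_two (p q : Polynomial ℚ) (hp : p.natDegree ≤ 2) (n : ℕ) (hn : 2 ≤ n) :
    (p * q).coeff n = p.coeff 0 * q.coeff n + p.coeff 1 * q.coeff (n - 1) + p.coeff 2 * q.coeff (n - 2) := by
  rw [Polynomial.coeff_mul]
  have hT : ({(0, n), (1, n - 1), (2, n - 2)} : Finset (ℕ × ℕ)) ⊆ Finset.HasAntidiagonal.antidiagonal n := by
    intro x hx
    simp only [Finset.mem_insert, Finset.mem_singleton] at hx
    rw [Finset.HasAntidiagonal.mem_antidiagonal]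
    rcases hx with rfl | rfl | rfl <;> dsimp only <;> omega
  rw [← Finset.sum_subset hT]
  · rw [Finset.sum_insert (by simp), Finset.sum_insert (by simp), Finset.sum_singleton]
    ring
  · intro x hx hxT
    rw [Finset.HasAntidiagonal.mem_antidiagonal] at hx
    simp only [Finset.mem_insert, Finset.mem_singleton, not_or] at hxT
    by_cases h1 : 2 < x.1
    · rw [Polynomial.coeff_eq_zero_of_natDegree_lt (lt_of_le_of_lt hp h1), zero_mul]
    · exfalso
      obtain ⟨a, b⟩ := x
      dsimp only at hx h1 hxT
      rcases hxT with ⟨hA, hB, hC⟩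
      have : a = 0 ∨ a = 1 ∨ a = 2 := by omega
      rcases this with rfl | rfl | rfl
      · exact hA (Prod.ext rfl (by dsimp only; omega))
      · exact hB (Prod.ext rfl (by dsimp only; omega))
      · exact hC (Prod.ext rfl (by dsimp only; omega))

/-- `[X^d] p(X + c) = p_d + (d+1)c·p_{d+1}` when `deg p ≤ d + 1` (Taylor). [cite: Stanley2012EC1, §1.3 Prop. 1.3.7 eq. (1.28); lane plumbing] -/
private theorem coeff_comp_X_add_C_of_natDegree_le_succ (p : Polynomial ℚ) {d : ℕ} (hp : p.natDegree ≤ d + 1) (c : ℚ) :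
    (p.comp (Polynomial.X + Polynomial.C c)).coeff d = p.coeff d + ((d : ℚ) + 1) * c * p.coeff (d + 1) := by
  rw [← Polynomial.taylor_apply, Polynomial.taylor_coeff]
  have hdeg : (Polynomial.hasseDeriv d p).natDegree < 2 := by
    have := Polynomial.natDegree_hasseDeriv_le p d; omega
  rw [Polynomial.eval_eq_sum_range' hdeg, Finset.sum_range_succ, Finset.sum_range_succ, Finset.sum_range_zero, zero_add,
    Polynomial.hasseDeriv_coeff, Polynomial.hasseDeriv_coeff, zero_add, Nat.choose_self, show 1 + d = d + 1 by ring, Nat.choose_succ_self_right]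
  push_cast
  ring

/-- `[X^d] p(X + c) = p_d + (d+1)c·p_{d+1} + (d+2)(d+1)/2·c²·p_{d+2}` when `deg p ≤ d + 2` (Taylor). [cite: Stanley2012EC1, §1.3 Prop. 1.3.7 eq. (1.28); lane plumbing] -/
private theorem coeff_comp_X_add_C_of_natDegree_le_succ_succ (p : Polynomial ℚ) {d : ℕ} (hp : p.natDegree ≤ d + 2) (c : ℚ) :
    (p.comp (Polynomial.X + Polynomial.C c)).coeff d =
      p.coeff d + ((d : ℚ) + 1) * c * p.coeff (d + 1) + ((d : ℚ) + 2) * ((d : ℚ) + 1) / 2 * c ^ 2 * p.coeff (d + 2) := by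
  rw [← Polynomial.taylor_apply, Polynomial.taylor_coeff]
  have hdeg : (Polynomial.hasseDeriv d p).natDegree < 3 := by
    have := Polynomial.natDegree_hasseDeriv_le p d; omega
  rw [Polynomial.eval_eq_sum_range' hdeg, Finset.sum_range_succ, Finset.sum_range_succ, Finset.sum_range_succ, Finset.sum_range_zero, zero_add,
    Polynomial.hasseDeriv_coeff, Polynomial.hasseDeriv_coeff, Polynomial.hasseDeriv_coeff, zero_add, Nat.choose_self,
    show 1 + d = d + 1 by ring, Nat.choose_succ_self_right, show 2 + d = d + 2 by ring,
    show (d + 2).choose d = (d + 2).choose 2 by rw [show d + 2 = 2 + d by ring]; exact Nat.choose_symm_add.symm, Nat.cast_choose_two]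
  push_cast
  ring

/-! ### The alternating binomial sums `Σ (−1)^m m^e C(N,m) = 0`, `e = 0, 1, 2` -/

/-- The shift `Σ_{m ≤ N+1} (−1)^m m C(N+1,m) g(m) = −(N+1) Σ_{m ≤ N} (−1)^m C(N,m) g(m+1)` (`m C(N+1,m) = (N+1) C(N,m−1)`).
[cite: Stanley2012EC1, §1.3 Prop. 1.3.7 eq. (1.28); lane plumbing] -/
private theorem altBinom_shift (N : ℕ) (g : ℕ → ℚ) :
    ∑ m ∈ Finset.range (N + 2), ((-1 : ℚ) ^ m * m * ((N + 1).choose m : ℕ) * g m) =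
      -((N : ℚ) + 1) * ∑ m ∈ Finset.range (N + 1), ((-1 : ℚ) ^ m * (N.choose m : ℕ) * g (m + 1)) := by
  rw [Finset.sum_range_succ', Nat.cast_zero, mul_zero, zero_mul, zero_mul, add_zero, Finset.mul_sum]
  refine Finset.sum_congr rfl fun m _ => ?_
  have hnat := Nat.add_one_mul_choose_eq N m
  have hc : (((N + 1).choose (m + 1) : ℕ) : ℚ) * ((m : ℚ) + 1) = ((N : ℚ) + 1) * (N.choose m : ℕ) := by exact_mod_cast hnat.symm
  rw [pow_succ]
  push_cast
  linear_combination (-1 : ℚ) ^ m * (-1) * g (m + 1) * hc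

/-- The three alternating binomial sums at once: `Σ_m (−1)^m C(N,m) = Σ_m (−1)^m m C(N,m) = Σ_m (−1)^m m² C(N,m) = 0` for `N ≥ 3`
(`(1 − 1)^N` and two shifts). [cite: Stanley2012EC1, §1.3 Prop. 1.3.7 eq. (1.28); lane plumbing] -/
private theorem altBinom_sums (N : ℕ) (hN : 3 ≤ N) :
    (∑ m ∈ Finset.range (N + 1), ((-1 : ℚ) ^ m * (N.choose m : ℕ))) = 0 ∧
    (∑ m ∈ Finset.range (N + 1), ((-1 : ℚ) ^ m * m * (N.choose m : ℕ))) = 0 ∧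
    (∑ m ∈ Finset.range (N + 1), ((-1 : ℚ) ^ m * m * (N.choose m : ℕ) * m)) = 0 := by
  have h0 : ∀ k : ℕ, ∑ m ∈ Finset.range (k + 2), ((-1 : ℚ) ^ m * ((k + 1).choose m : ℕ)) = 0 := by
    intro k
    have h := add_pow (-1 : ℚ) 1 (k + 1)
    simp only [one_pow, mul_one] at h
    rw [← h, show (-1 : ℚ) + 1 = 0 by norm_num, zero_pow (by omega)]
  have h1 : ∀ k : ℕ, ∑ m ∈ Finset.range (k + 3), ((-1 : ℚ) ^ m * m * ((k + 2).choose m : ℕ)) = 0 := by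
    intro k
    have h := altBinom_shift (k + 1) (fun _ => 1)
    simp only [mul_one] at h
    rw [show k + 1 + 2 = k + 3 from rfl, show k + 1 + 1 = k + 2 from rfl] at h
    rw [h, h0 k, mul_zero]
  obtain ⟨n, rfl⟩ : ∃ n, N = n + 3 := ⟨N - 3, by omega⟩
  refine ⟨?_, ?_, ?_⟩
  · have h := h0 (n + 2)
    rw [show n + 2 + 2 = n + 3 + 1 from rfl, show n + 2 + 1 = n + 3 from rfl] at h
    exact h
  · have h := h1 (n + 1)
    rw [show n + 1 + 3 = n + 3 + 1 from rfl, show n + 1 + 2 = n + 3 from rfl] at h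
    exact h
  · have h := altBinom_shift (n + 2) (fun m => (m : ℚ))
    rw [show n + 2 + 2 = n + 3 + 1 from rfl, show n + 2 + 1 = n + 3 from rfl] at h
    rw [h]
    have hsplit : ∑ m ∈ Finset.range (n + 3), ((-1 : ℚ) ^ m * ((n + 2).choose m : ℕ) * (((m + 1 : ℕ) : ℚ))) =
        ∑ m ∈ Finset.range (n + 3), ((-1 : ℚ) ^ m * m * ((n + 2).choose m : ℕ)) + ∑ m ∈ Finset.range (n + 3), ((-1 : ℚ) ^ m * ((n + 2).choose m : ℕ)) := by
      rw [← Finset.sum_add_distrib]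
      refine Finset.sum_congr rfl fun m _ => ?_
      push_cast; ring
    have h0' := h0 (n + 1)
    rw [show n + 1 + 2 = n + 3 from rfl, show n + 1 + 1 = n + 2 from rfl] at h0'
    rw [hsplit, h1 n, h0', add_zero, mul_zero]

/-! ### The third-layer law and the summands of `B_j` two below their top -/

/-- The THIRD-LAYER LAW at order `i`: `[X^{2i−5}] R_i = (8i⁴ − 13i³ − 8i² + 28i − 48)/(9·2^i·(i−2)!)` (meaningful for `i ≥ 3`; FINDING-ZD-SYMBOL-POLYNOMIALITY
§16 (ii): the six-corner formula with the third-layer censuses in closed form; `29/8, 4, 121/64, 77/144` at `i = 3…6` = the tree's `R₃…R₆`).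
[cite: MadrasSlade1993, Definition 1.2.4; lane tool notion] -/
def ThirdLayerCoeff (i : ℕ) : Prop :=
  (symbolPoly i).coeff (2 * i - 5) = (8 * (i : ℚ) ^ 4 - 13 * (i : ℚ) ^ 3 - 8 * (i : ℚ) ^ 2 + 28 * i - 48) / (9 * 2 ^ i * ((i - 2).factorial : ℚ))

/-- The uniform value of the `X^{2j−5}`-coefficient of the `i`-th summand `R_i·E_{j−i}(X−i)` of `B_j` under the layer laws, in `m = i − 2`, `k = j − i`:
`(−1)^k P(i;j)/(18·2^j·m!·k!)`, `P(i;j) = 4j⁴ − 13j² − 9j − 96 + i(8j³ − 8j² − 20j + 65) + i²(4j² − 18j + 17)` — QUADRATIC in `i`.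
[cite: MadrasSlade1993, §1.1 eq. (1.1.8) p. 5; lane tool notion] -/
def thirdTermVal (m k : ℕ) : ℚ :=
  (-1) ^ k * (4 * ((m : ℚ) + 2 + k) ^ 4 - 13 * ((m : ℚ) + 2 + k) ^ 2 - 9 * ((m : ℚ) + 2 + k) - 96
      + ((m : ℚ) + 2) * (8 * ((m : ℚ) + 2 + k) ^ 3 - 8 * ((m : ℚ) + 2 + k) ^ 2 - 20 * ((m : ℚ) + 2 + k) + 65)
      + ((m : ℚ) + 2) ^ 2 * (4 * ((m : ℚ) + 2 + k) ^ 2 - 18 * ((m : ℚ) + 2 + k) + 17)) /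
    (18 * 2 ^ (m + 2 + k) * ((m.factorial : ℚ) * (k.factorial : ℚ)))

/-- The `i = j` summand (`E₀ = 1`): `[X^{2j−5}] R_j = T₃(j−2, 0)` under `ThirdLayerCoeff j`. [cite: MadrasSlade1993, §1.1 eq. (1.1.8) p. 5; lane lemma] -/
theorem coeff_third_term_self (m : ℕ) (h3 : ThirdLayerCoeff (m + 2)) :
    (symbolPoly (m + 2) * (stirlingPoly (m + 2 - (m + 2))).comp (Polynomial.X - Polynomial.C ((m + 2 : ℕ) : ℚ))).coeff (2 * (m + 2) - 5) =
      thirdTermVal m 0 := by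
  unfold ThirdLayerCoeff at h3
  rw [Nat.sub_self, stirlingPoly_zero, Polynomial.one_comp, mul_one, h3, thirdTermVal, show m + 2 - 2 = m by omega]
  push_cast
  have hf : (m.factorial : ℚ) ≠ 0 := by exact_mod_cast m.factorial_ne_zero
  rw [Nat.factorial_zero, Nat.cast_one]
  field_simp
  ring

/-- The shifted Stirling factor `G = E_k(X − i)`: degree `2k` and its top three coefficients (`k ≥ 1`).
[cite: Stanley2012EC1, §1.3 Prop. 1.3.7 eq. (1.28); lane plumbing] -/
private theorem stirling_shift_coeffs (k : ℕ) (hk : 1 ≤ k) (i : ℚ) :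
    ((stirlingPoly k).comp (Polynomial.X - Polynomial.C i)).natDegree = 2 * k ∧
    ((stirlingPoly k).comp (Polynomial.X - Polynomial.C i)).coeff (2 * k) = (-1) ^ k / (2 ^ k * (k.factorial : ℚ)) ∧
    ((stirlingPoly k).comp (Polynomial.X - Polynomial.C i)).coeff (2 * k - 1) =
      (-1) ^ (k + 1) * ((k : ℚ) * (2 * k + 1)) / (3 * 2 ^ k * (k.factorial : ℚ)) + (((2 * k - 1 : ℕ) : ℚ) + 1) * (-i) * ((-1) ^ k / (2 ^ k * (k.factorial : ℚ))) ∧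
    ((stirlingPoly k).comp (Polynomial.X - Polynomial.C i)).coeff (2 * k - 2) =
      (-1) ^ k * ((k : ℚ) * (k - 1) * (4 * k ^ 2 + 4 * k + 3)) / (18 * 2 ^ k * (k.factorial : ℚ))
        + (((2 * k - 2 : ℕ) : ℚ) + 1) * (-i) * ((-1) ^ (k + 1) * ((k : ℚ) * (2 * k + 1)) / (3 * 2 ^ k * (k.factorial : ℚ)))
        + (((2 * k - 2 : ℕ) : ℚ) + 2) * (((2 * k - 2 : ℕ) : ℚ) + 1) / 2 * (-i) ^ 2 * ((-1) ^ k / (2 ^ k * (k.factorial : ℚ))) := by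
  have hGX : Polynomial.X - Polynomial.C i = Polynomial.X + Polynomial.C (-i) := by rw [map_neg, sub_eq_add_neg]
  have hdeg : (stirlingPoly k).natDegree = 2 * k := natDegree_stirlingPoly k
  have htop : (stirlingPoly k).coeff (2 * k) = (-1) ^ k / (2 ^ k * (k.factorial : ℚ)) := (natDegree_stirlingPoly_le_and_coeff k).2
  have hGdeg : ((stirlingPoly k).comp (Polynomial.X - Polynomial.C i)).natDegree = 2 * k := by
    rw [Polynomial.natDegree_comp, hdeg, Polynomial.natDegree_X_sub_C]; ring
  refine ⟨hGdeg, ?_, ?_, ?_⟩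
  · have hlc : ((stirlingPoly k).comp (Polynomial.X - Polynomial.C i)).leadingCoeff = (stirlingPoly k).leadingCoeff := by
      rw [Polynomial.leadingCoeff_comp (by rw [Polynomial.natDegree_X_sub_C]; exact one_ne_zero), (Polynomial.monic_X_sub_C _).leadingCoeff, one_pow, mul_one]
    rw [Polynomial.leadingCoeff, hGdeg, leadingCoeff_stirlingPoly] at hlc
    exact hlc
  · rw [hGX, coeff_comp_X_add_C_of_natDegree_le_succ _ (by rw [hdeg]; omega), coeff_stirlingPoly_two_mul_sub_one k hk,
      show 2 * k - 1 + 1 = 2 * k by omega, htop]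
  · rw [hGX, coeff_comp_X_add_C_of_natDegree_le_succ_succ _ (by rw [hdeg]; omega), coeff_stirlingPoly_two_mul_sub_two k hk,
      show 2 * k - 2 + 1 = 2 * k - 1 by omega, coeff_stirlingPoly_two_mul_sub_one k hk, show 2 * k - 2 + 2 = 2 * k by omega, htop]

/-- The `2 < i < j` summands: `[X^{2j−5}](R_i·E_k(X−i)) = T₃(i−2, k)` (`i = m + 2 ≥ 3`, `k ≥ 1`) under `SecondLayerSums i` and `ThirdLayerCoeff i` —
three products of the top three coefficients of both factors; the quartic and cubic parts in `i` cancel. [cite: MadrasSlade1993, §1.1 eq. (1.1.8) p. 5; lane lemma] -/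
theorem coeff_third_term_lt (m k : ℕ) (hm : 1 ≤ m) (hk : 1 ≤ k) (h2 : SecondLayerSums (m + 2)) (h3 : ThirdLayerCoeff (m + 2)) :
    (symbolPoly (m + 2) * (stirlingPoly (m + 2 + k - (m + 2))).comp (Polynomial.X - Polynomial.C ((m + 2 : ℕ) : ℚ))).coeff (2 * (m + 2 + k) - 5) =
      thirdTermVal m k := by
  rw [show m + 2 + k - (m + 2) = k by omega]
  obtain ⟨hGdeg, hGtop, hGsub, hGthird⟩ := stirling_shift_coeffs k hk ((m + 2 : ℕ) : ℚ)
  set G : Polynomial ℚ := (stirlingPoly k).comp (Polynomial.X - Polynomial.C ((m + 2 : ℕ) : ℚ)) with hG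
  have hRdeg : (symbolPoly (m + 2)).natDegree = 2 * m + 1 := by rw [natDegree_symbolPoly (m + 2) (by omega)]; omega
  have hRtop : (symbolPoly (m + 2)).coeff (2 * m + 1) = (1 / 2) ^ (m + 2) / (m.factorial : ℚ) := by
    rw [show 2 * m + 1 = 2 * (m + 2) - 3 by omega, coeff_symbolPoly_two_mul_sub_three (m + 2) (by omega), show m + 2 - 2 = m by omega]
  have hRsub : (symbolPoly (m + 2)).coeff (2 * m) = -((4 * ((m : ℚ) + 2) ^ 2 - 2 * ((m : ℚ) + 2) - 3) / (3 * 2 ^ (m + 2) * (m.factorial : ℚ))) := by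
    rw [show 2 * m = 2 * (m + 2) - 4 by omega, coeff_symbolPoly_two_mul_sub_four_of_sums (m + 2) (by omega) h2.1 h2.2, show m + 2 - 2 = m by omega]
    push_cast; ring
  have hRthird : (symbolPoly (m + 2)).coeff (2 * m - 1) =
      (8 * ((m : ℚ) + 2) ^ 4 - 13 * ((m : ℚ) + 2) ^ 3 - 8 * ((m : ℚ) + 2) ^ 2 + 28 * ((m : ℚ) + 2) - 48) / (9 * 2 ^ (m + 2) * (m.factorial : ℚ)) := by
    unfold ThirdLayerCoeff at h3
    rw [show 2 * m - 1 = 2 * (m + 2) - 5 by omega, h3, show m + 2 - 2 = m by omega]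
    push_cast; ring
  obtain ⟨m', rfl⟩ : ∃ m', m = m' + 1 := ⟨m - 1, by omega⟩
  obtain ⟨k', rfl⟩ : ∃ k', k = k' + 1 := ⟨k - 1, by omega⟩
  rw [show 2 * (m' + 1 + 2 + (k' + 1)) - 5 = (2 * m' + 1) + (2 * k') + 2 by omega,
    coeff_mul_three_of_natDegree_le _ _ (2 * m' + 1) (2 * k') (by rw [hRdeg]; omega) (by rw [hGdeg]; omega),
    show 2 * m' + 1 = 2 * (m' + 1) - 1 by omega, hRthird, show 2 * (m' + 1) - 1 + 1 = 2 * (m' + 1) by omega, hRsub,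
    show 2 * (m' + 1) - 1 + 2 = 2 * (m' + 1) + 1 by omega, hRtop, show 2 * k' + 2 = 2 * (k' + 1) by omega, hGtop,
    show 2 * k' + 1 = 2 * (k' + 1) - 1 by omega, hGsub, show 2 * k' = 2 * (k' + 1) - 2 by omega, hGthird, thirdTermVal,
    show 2 * (k' + 1) - 2 = 2 * k' by omega, show 2 * (k' + 1) - 1 = 2 * k' + 1 by omega, Nat.factorial_succ m', Nat.factorial_succ k']
  push_cast
  have hf : (m'.factorial : ℚ) ≠ 0 := by exact_mod_cast m'.factorial_ne_zero
  have hkf : (k'.factorial : ℚ) ≠ 0 := by exact_mod_cast k'.factorial_ne_zero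
  have hm1 : (m' : ℚ) + 1 ≠ 0 := by positivity
  have hk1 : (k' : ℚ) + 1 ≠ 0 := by positivity
  simp only [one_div, inv_pow]
  field_simp
  ring

/-- The `i = 2` summand (`R₂ = (X−3)/4`, no third coefficient): `[X^{2j−5}](R₂·E_{j−2}(X−2)) = T₃(0, j−2)` (`j − 2 = k ≥ 2`).
[cite: MadrasSlade1993, §1.1 eq. (1.1.8) p. 5; lane lemma] -/
theorem coeff_third_term_two (N : ℕ) (hN : 2 ≤ N) :
    (symbolPoly (0 + 2) * (stirlingPoly (N + 2 - (0 + 2))).comp (Polynomial.X - Polynomial.C ((0 + 2 : ℕ) : ℚ))).coeff (2 * (N + 2) - 5) =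
      thirdTermVal 0 N := by
  rw [show N + 2 - (0 + 2) = N by omega, show (0 + 2 : ℕ) = 2 from rfl]
  obtain ⟨hGdeg, -, hGsub, hGthird⟩ := stirling_shift_coeffs N (by omega) ((2 : ℕ) : ℚ)
  have hRdeg : (symbolPoly 2).natDegree ≤ 2 := by rw [natDegree_symbolPoly 2 le_rfl]; norm_num
  have hRtop : (symbolPoly 2).coeff 1 = (1 / 2) ^ 2 / (Nat.factorial 0 : ℚ) := by
    rw [show 1 = 2 * 2 - 3 by omega, coeff_symbolPoly_two_mul_sub_three 2 le_rfl]
  have hRsub : (symbolPoly 2).coeff 0 = -((4 * (2 : ℚ) ^ 2 - 2 * 2 - 3) / (3 * 2 ^ 2 * (Nat.factorial 0 : ℚ))) := by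
    rw [show 0 = 2 * 2 - 4 by omega, coeff_symbolPoly_two_mul_sub_four_of_sums 2 le_rfl secondLayerSums_two.1 secondLayerSums_two.2]
    push_cast; ring
  have hR2 : (symbolPoly 2).coeff 2 = 0 := Polynomial.coeff_eq_zero_of_natDegree_lt (by rw [natDegree_symbolPoly 2 le_rfl]; norm_num)
  obtain ⟨k', rfl⟩ : ∃ k', N = k' + 2 := ⟨N - 2, by omega⟩
  rw [show 2 * (k' + 2 + 2) - 5 = 2 * k' + 3 by omega, coeff_mul_three_of_natDegree_le_two _ _ hRdeg (2 * k' + 3) (by omega), hR2, zero_mul, add_zero,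
    hRsub, hRtop, show 2 * k' + 3 = 2 * (k' + 2) - 1 by omega, hGsub, show 2 * (k' + 2) - 1 - 1 = 2 * (k' + 2) - 2 by omega, hGthird, thirdTermVal,
    show 2 * (k' + 2) - 2 = 2 * k' + 2 by omega, show 2 * (k' + 2) - 1 = 2 * k' + 3 by omega, Nat.factorial_zero, Nat.factorial_succ (k' + 1), Nat.factorial_succ k']
  push_cast
  have hkf : (k'.factorial : ℚ) ≠ 0 := by exact_mod_cast k'.factorial_ne_zero
  have hk1 : (k' : ℚ) + 1 ≠ 0 := by positivity
  have hk2 : (k' : ℚ) + 2 ≠ 0 := by positivity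
  have hk3 : (k' : ℚ) + 1 + 1 ≠ 0 := by positivity
  simp only [one_div, inv_pow]
  field_simp
  ring

/-! ### ★★★ The third cancellation -/

/-- The reindexed sum vanishes: `Σ_{m ≤ N} T₃(m, N − m) = 0` for `N ≥ 3` (the bracket is quadratic in `m`; three alternating binomial sums).
[cite: MadrasSlade1993, §1.1 eq. (1.1.8) p. 5; lane lemma] -/
theorem sum_thirdTermVal_eq_zero (N : ℕ) (hN : 3 ≤ N) : ∑ m ∈ Finset.range (N + 1), thirdTermVal m (N - m) = 0 := by
  -- `T₃(m, N−m)·18·2^{N+2}·N!·(−1)^N = (−1)^m C(N,m)(A + Bm + Cm²)`, `J = N + 2`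
  set J : ℚ := (N : ℚ) + 2 with hJ
  set C : ℚ := 4 * J ^ 2 - 18 * J + 17 with hC
  set B : ℚ := (8 * J ^ 3 - 8 * J ^ 2 - 20 * J + 65) + 4 * C with hB
  set A : ℚ := 4 * J ^ 4 - 13 * J ^ 2 - 9 * J - 96 + 2 * (8 * J ^ 3 - 8 * J ^ 2 - 20 * J + 65) + 4 * C with hA
  have hterm : ∀ m ∈ Finset.range (N + 1), thirdTermVal m (N - m) =
      (-1) ^ N / (18 * 2 ^ (N + 2) * (N.factorial : ℚ)) * ((-1 : ℚ) ^ m * (N.choose m : ℕ) * (A + B * m + C * m * m)) := by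
    intro m hm
    have hmN : m ≤ N := by have := Finset.mem_range.1 hm; omega
    rw [thirdTermVal, Nat.cast_choose ℚ hmN]
    have hcast : ((m : ℚ) + 2 + ((N - m : ℕ) : ℚ)) = J := by rw [Nat.cast_sub hmN, hJ]; ring
    have hpow2 : (2 : ℚ) ^ (m + 2 + (N - m)) = 2 ^ (N + 2) := by rw [show m + 2 + (N - m) = N + 2 by omega]
    have hsign : (-1 : ℚ) ^ (N - m) = (-1) ^ N * (-1) ^ m := by
      have h1 : (-1 : ℚ) ^ (N - m) * (-1) ^ m = (-1) ^ N := by rw [← pow_add]; congr 1; omega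
      have h2 : (-1 : ℚ) ^ m * (-1) ^ m = 1 := by rw [← mul_pow]; norm_num
      calc (-1 : ℚ) ^ (N - m) = (-1) ^ (N - m) * ((-1) ^ m * (-1) ^ m) := by rw [h2, mul_one]
        _ = (-1) ^ N * (-1) ^ m := by rw [← mul_assoc, h1]
    rw [hcast, hpow2, hsign, hA, hB, hC]
    have hf1 : (m.factorial : ℚ) ≠ 0 := by exact_mod_cast m.factorial_ne_zero
    have hf2 : ((N - m).factorial : ℚ) ≠ 0 := by exact_mod_cast (N - m).factorial_ne_zero
    have hf3 : (N.factorial : ℚ) ≠ 0 := by exact_mod_cast N.factorial_ne_zero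
    field_simp
    ring
  rw [Finset.sum_congr rfl hterm, ← Finset.mul_sum]
  have hsum : ∑ m ∈ Finset.range (N + 1), ((-1 : ℚ) ^ m * (N.choose m : ℕ) * (A + B * m + C * m * m)) = 0 := by
    have : ∀ m ∈ Finset.range (N + 1), ((-1 : ℚ) ^ m * (N.choose m : ℕ) * (A + B * m + C * m * m)) =
        A * ((-1 : ℚ) ^ m * (N.choose m : ℕ)) + B * ((-1 : ℚ) ^ m * m * (N.choose m : ℕ)) + C * ((-1 : ℚ) ^ m * m * (N.choose m : ℕ) * m) := by
      intro m _; ring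
    rw [Finset.sum_congr rfl this, Finset.sum_add_distrib, Finset.sum_add_distrib, ← Finset.mul_sum, ← Finset.mul_sum, ← Finset.mul_sum,
      (altBinom_sums N hN).1, (altBinom_sums N hN).2.1, (altBinom_sums N hN).2.2, mul_zero, mul_zero, mul_zero, add_zero, add_zero]
  rw [hsum, mul_zero]

/-- ★★★ THIRD CANCELLATION (conditional on the layer laws): for every `j ≥ 5`, if `SecondLayerSums i` (the two second-layer census closed forms) and
`ThirdLayerCoeff i` (the third-layer coefficient law of `R_i`) hold for all `3 ≤ i ≤ j`, then the `X^{2j−5}`-coefficient of the bad-word correction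
`B_j = Σ_{i=2}^{j} R_i(X) E_{j−i}(X−i)` VANISHES — the summands' values `(−1)^{j−i} P(i;j)/(18·2^j (i−2)!(j−i)!)` are QUADRATIC in `i` and the three
alternating binomial sums kill them. [cite: MadrasSlade1993, §1.1 eq. (1.1.8) p. 5; Definition 1.2.4] [cite: ClisbyLiangSlade2007, §3.3 eqs. (29)/(31); lane theorem] -/
theorem coeff_symbolCorrPoly_two_mul_sub_five_eq_zero (j : ℕ) (hj : 5 ≤ j) (h2 : ∀ i, 3 ≤ i → i ≤ j → SecondLayerSums i)
    (h3 : ∀ i, 3 ≤ i → i ≤ j → ThirdLayerCoeff i) : (symbolCorrPoly j).coeff (2 * j - 5) = 0 := by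
  obtain ⟨N, rfl⟩ : ∃ N, j = N + 2 := ⟨j - 2, by omega⟩
  unfold symbolCorrPoly
  rw [Polynomial.finsetSum_coeff]
  have himage : Finset.Ico 2 (N + 2 + 1) = (Finset.range (N + 1)).image (fun m => m + 2) := by
    ext i; simp only [Finset.mem_Ico, Finset.mem_image, Finset.mem_range]; constructor
    · intro hi; exact ⟨i - 2, by omega, by omega⟩
    · rintro ⟨m, hm, rfl⟩; omega
  rw [himage, Finset.sum_image (fun a _ b _ h => by omega)]
  rw [← sum_thirdTermVal_eq_zero N (by omega)]
  refine Finset.sum_congr rfl fun m hm => ?_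
  have hmN : m ≤ N := by have := Finset.mem_range.1 hm; omega
  rcases Nat.eq_zero_or_pos m with rfl | hpos
  · rw [Nat.sub_zero]
    exact coeff_third_term_two N (by omega)
  · rcases Nat.eq_or_lt_of_le hmN with rfl | hlt
    · have := coeff_third_term_self m (h3 (m + 2) (by omega) le_rfl)
      simp only [Nat.sub_self] at this ⊢
      exact this
    · have := coeff_third_term_lt m (N - m) hpos (by omega) (h2 (m + 2) (by omega) (by omega)) (h3 (m + 2) (by omega) (by omega))
      rw [show m + 2 + (N - m) = N + 2 by omega] at this
      exact this

/-- ★★★ Hence, under the same hypotheses, `deg B_j ≤ 2j − 6` for every `j ≥ 5` — the third of the `j − 3` cancellations predicted by the STRUCTURE CONJECTURE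
«`deg P_j = j`». [cite: MadrasSlade1993, §1.1 eq. (1.1.8) p. 5; Definition 1.2.4] [cite: ClisbyLiangSlade2007, §3.3 eqs. (29)/(31); lane theorem] -/
theorem natDegree_symbolCorrPoly_le_sub_six (j : ℕ) (hj : 5 ≤ j) (h2 : ∀ i, 3 ≤ i → i ≤ j → SecondLayerSums i)
    (h3 : ∀ i, 3 ≤ i → i ≤ j → ThirdLayerCoeff i) : (symbolCorrPoly j).natDegree ≤ 2 * j - 6 := by
  have hle := natDegree_symbolCorrPoly_le_sub_five j (by omega) h2
  by_contra hlt
  have heq : (symbolCorrPoly j).natDegree = 2 * j - 5 := by omega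
  have hne : symbolCorrPoly j ≠ 0 := by
    intro h0; rw [h0, Polynomial.natDegree_zero] at heq; omega
  have := Polynomial.leadingCoeff_ne_zero.2 hne
  rw [Polynomial.leadingCoeff, heq, coeff_symbolCorrPoly_two_mul_sub_five_eq_zero j hj h2 h3] at this
  exact this rfl

/-- ★★ And `deg S_j ≤ max(j, 2j − 6)` (`j ≥ 5`) under the layer laws — so `S_5` has degree exactly `5` and `S_6` degree `≤ 6`.
[cite: MadrasSlade1993, §1.1 eq. (1.1.8) p. 5; Definition 1.2.4] [cite: ClisbyLiangSlade2007, §3.3 eqs. (29)/(31); lane theorem] -/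
theorem natDegree_coeffPoly_le_of_thirdLayer (j : ℕ) (hj : 5 ≤ j) (h2 : ∀ i, 3 ≤ i → i ≤ j → SecondLayerSums i)
    (h3 : ∀ i, 3 ≤ i → i ≤ j → ThirdLayerCoeff i) : (coeffPoly j).natDegree ≤ max j (2 * j - 6) := by
  rw [coeffPoly]
  refine (Polynomial.natDegree_sub_le _ _).trans (max_le ?_ ?_)
  · rw [natDegree_symbolMainPoly]; exact le_max_left _ _
  · exact (natDegree_symbolCorrPoly_le_sub_six j hj h2 h3).trans (le_max_right _ _)

end WordTypes

end Literature.Probability.RandomPlanarGeometry.SAW.Zd
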